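import Literature.Analysis.FunctionSpaces.LittlewoodPaleyContDiffHolderProofs
import Literature.Analysis.FunctionSpaces.LittlewoodPaleyLowFrequencyRep
import HarnessLib

/-!
# `B^{k+r}_{∞,∞} ⊂ C^{k,r}_b` with explicit constants (Schauder program, item A′4(b))

Topic `Literature/Analysis/FunctionSpaces`. Quantitative clone of
`exists_memContDiffHolder_coe_eq_of_memBesov_top_top` (`LittlewoodPaleyContDiffHolderProofs.lean`;
Triebel 1983, Thm. 2.5.7): the same proof, with the low-frequency representative taken from the
quantitative `exists_smooth_rep_lowFreqCutoff_zero_quant` (A′4(a)), exporting the constants.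
There are `K₁, K₂ < ∞` depending only on `k`, `r` (and the dimension) such that every
`u ∈ 𝓢'(E, F)` with finite `S = ‖Ṡ₀ u‖_{L^∞}` and `N = sup_{j ≥ 1} 2^{j(k+r)} ‖Δ̇_j u‖_{L^∞}` is the
distribution of an `f ∈ C^{k,r}_b` with

  `‖Dᵐ f(x)‖ ≤ K₁ (S + N)` (`m ≤ k`),  `‖Dᵏf(x) − Dᵏf(y)‖ ≤ K₂ (S + N) ‖x − y‖ʳ`.

This is the Besov → Hölder half of the norm equivalence behind the constant-coefficient Schauder
estimate `[D²u]_α ≤ C([Δu]_α + ‖u‖_∞)` (Gilbarg–Trudinger 2001, Thm. 4.8), census item (2a) of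
`Literature.Geometry.Riemannian.gurskyViaclovsky_pathOpen_weighted_four`. Everything is proved; no
named facts.

## References

* H. Triebel, *Theory of Function Spaces* (1983), Thm. 2.5.7. [Triebel1983]
* D. Gilbarg, N. S. Trudinger, *Elliptic Partial Differential Equations of Second Order* (2001),
  Thm. 4.8. [GilbargTrudinger2001]
-/

noncomputable section

open MeasureTheory FourierTransform SchwartzMap Real Filter Topology Function TemperedDistribution
open scoped SchwartzMap ENNReal NNReal FourierTransform RealInnerProductSpace Convolution ContDiff

namespace Literature.Analysis.FunctionSpaces

section Twins

variable {E : Type*} [NormedAddCommGroup E] [InnerProductSpace ℝ E] [FiniteDimensional ℝ E]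
  [MeasurableSpace E] [BorelSpace E] {F : Type*} [NormedAddCommGroup F] [NormedSpace ℂ F]
  [CompleteSpace F]

/-- The weighted sup bounds each block: `‖Δ̇_{n+1} u‖_{L^p} ≤ 2^{-(n+1)s} sup_m 2^{(m+1)s} ‖Δ̇_{m+1} u‖_{L^p}`.
(Private twin of `eLpNormDistrib_lpBlock_succ_le` of `LittlewoodPaleyHolderProofs.lean`, not
imported here.) [folklore] -/
private theorem eLpNormDistrib_lpBlock_succ_le'' (s : ℝ) (p : ℝ≥0∞) [Fact (1 ≤ p)] (u : 𝓢'(E, F)) (n : ℕ) :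
    eLpNormDistrib p (lpBlock ((n : ℤ) + 1) u) ≤
      (2 : ℝ≥0∞) ^ (-((((n : ℤ) + 1 : ℤ) : ℝ) * s)) * eLpNorm (lpBlockWeightSucc s p u) ∞ Measure.count := by
  have h1 : lpBlockWeightSucc s p u n ≤ eLpNorm (lpBlockWeightSucc s p u) ∞ Measure.count := by
    rw [eLpNorm_exponent_top, eLpNormEssSup_count]
    simp only [enorm_eq_self]
    exact le_iSup (fun n => lpBlockWeightSucc s p u n) n
  rw [lpBlockWeightSucc, lpBlockWeight] at h1
  have h2 : (2 : ℝ≥0∞) ^ (-((((n : ℤ) + 1 : ℤ) : ℝ) * s)) * ((2 : ℝ≥0∞) ^ ((((n : ℤ) + 1 : ℤ) : ℝ) * s) *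
      eLpNormDistrib p (lpBlock ((n : ℤ) + 1) u)) = eLpNormDistrib p (lpBlock ((n : ℤ) + 1) u) := by
    rw [← mul_assoc, ← ENNReal.rpow_add _ _ two_ne_zero ENNReal.ofNat_ne_top, neg_add_cancel,
      ENNReal.rpow_zero, one_mul]
  calc eLpNormDistrib p (lpBlock ((n : ℤ) + 1) u)
      = (2 : ℝ≥0∞) ^ (-((((n : ℤ) + 1 : ℤ) : ℝ) * s)) * ((2 : ℝ≥0∞) ^ ((((n : ℤ) + 1 : ℤ) : ℝ) * s) *
          eLpNormDistrib p (lpBlock ((n : ℤ) + 1) u)) := h2.symm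
    _ ≤ (2 : ℝ≥0∞) ^ (-((((n : ℤ) + 1 : ℤ) : ℝ) * s)) * eLpNorm (lpBlockWeightSucc s p u) ∞ Measure.count := by
        gcongr

/-- The embedding `L^∞ → 𝓢'` is additive. (Private twin of `coe_add_toTemperedDistribution` of
`LittlewoodPaleyHolderProofs.lean`, not imported here.) [folklore] -/
private theorem coe_add_toTemperedDistribution'' (a b : Lp F ∞ (volume : Measure E)) :
    (((a + b : Lp F ∞ (volume : Measure E))) : 𝓢'(E, F)) = (a : 𝓢'(E, F)) + (b : 𝓢'(E, F)) := by
  rw [← Lp.toTemperedDistributionCLM_apply, ← Lp.toTemperedDistributionCLM_apply,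
    ← Lp.toTemperedDistributionCLM_apply, map_add]

end Twins

section BesovToHolderQuant

variable {E : Type*} [NormedAddCommGroup E] [InnerProductSpace ℝ E] [FiniteDimensional ℝ E]
  [MeasurableSpace E] [BorelSpace E] {F : Type*} [NormedAddCommGroup F] [NormedSpace ℂ F]
  [CompleteSpace F]

/-- **`B^{k+r}_{∞,∞} ⊂ C^{k,r}_b` with explicit constants** (`0 < r < 1`): see the module
docstring. Same proof as `exists_memContDiffHolder_coe_eq_of_memBesov_top_top`, constants
exported. [cite: Triebel1983, Thm. 2.5.7] -/
theorem exists_memContDiffHolder_coe_eq_of_memBesov_top_top_quant (k : ℕ) {r : ℝ≥0} (hr₀ : 0 < r)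
    (hr₁ : r < 1) :
    ∃ (K₁ K₂ : ℝ≥0∞), K₁ < ⊤ ∧ K₂ < ⊤ ∧ ∀ (u : 𝓢'(E, F)), MemBesov ((k : ℝ) + r) ∞ ∞ u →
      ∃ (f : E → F) (hf : MemLp f ∞ (volume : Measure E)),
        MemContDiffHolder k r f ∧ ((hf.toLp f : Lp F ∞ (volume : Measure E)) : 𝓢'(E, F)) = u ∧
        (∀ m : ℕ, m ≤ k → ∀ x : E, ‖iteratedFDeriv ℝ m f x‖ₑ ≤
          K₁ * (eLpNormDistrib ∞ (lowFreqCutoff 0 u) +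
            eLpNorm (lpBlockWeightSucc ((k : ℝ) + r) ∞ u) ∞ Measure.count)) ∧
        ∀ x y : E, edist (iteratedFDeriv ℝ k f x) (iteratedFDeriv ℝ k f y) ≤
          K₂ * (eLpNormDistrib ∞ (lowFreqCutoff 0 u) +
            eLpNorm (lpBlockWeightSucc ((k : ℝ) + r) ∞ u) ∞ Measure.count) * edist x y ^ (r : ℝ) := by
  set s : ℝ := (k : ℝ) + r with hs
  have hr0 : (0 : ℝ) < r := hr₀
  have hr1 : (r : ℝ) < 1 := hr₁
  -- the u-independent constants
  obtain ⟨A, C, hA0, hCtop, hrep⟩ := exists_smooth_rep_lpBlock (E := E) (F := F)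
  obtain ⟨A₀, C₀, hA₀0, hC₀top, hrep₀⟩ := exists_smooth_rep_lowFreqCutoff_zero_quant (E := E) (F := F)
  obtain ⟨K, hKtop, hK⟩ := exists_tsum_min_mul_rpow_neg_le hr0 hr1
  -- the geometric constants `c m = ρ_m / (1 - ρ_m)`, `ρ_m = 2^{m-s}`
  set ρ : ℕ → ℝ := fun m => (2 : ℝ) ^ ((m : ℝ) - s) with hρ
  have hρ0' : ∀ m, 0 ≤ ρ m := fun m => Real.rpow_nonneg zero_le_two _
  have hρ1' : ∀ m : ℕ, m ≤ k → ρ m < 1 := by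
    intro m hm
    refine Real.rpow_lt_one_of_one_lt_of_neg one_lt_two ?_
    have : (m : ℝ) ≤ k := by exact_mod_cast hm
    rw [hs]; linarith
  set c : ℕ → ℝ := fun m => ρ m * (1 - ρ m)⁻¹ with hc
  have hc0 : ∀ m : ℕ, m ≤ k → 0 ≤ c m := fun m hm =>
    mul_nonneg (hρ0' m) (inv_nonneg.2 (by linarith [hρ1' m hm]))
  set K₁ : ℝ≥0∞ := ∑ m ∈ Finset.range (k + 1),
    (ENNReal.ofReal (A₀ m) * C₀ + ENNReal.ofReal (A m * c m) * C) with hK₁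
  set A' : ℝ := max (A k) (A (k + 1)) with hA'
  have hA'0 : 0 ≤ A' := (hA0 k).trans (le_max_left _ _)
  set K₂ : ℝ≥0∞ := ENNReal.ofReal (A₀ (k + 1) + 2 * A₀ k) * C₀ + ENNReal.ofReal (2 * A') * C * K
    with hK₂
  have hK₁top : K₁ < ⊤ := by
    refine ENNReal.sum_lt_top.2 fun m _ => ENNReal.add_lt_top.2 ⟨?_, ?_⟩
    · exact ENNReal.mul_lt_top ENNReal.ofReal_lt_top hC₀top
    · exact ENNReal.mul_lt_top ENNReal.ofReal_lt_top hCtop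
  have hK₂top : K₂ < ⊤ := by
    refine ENNReal.add_lt_top.2 ⟨ENNReal.mul_lt_top ENNReal.ofReal_lt_top hC₀top, ?_⟩
    exact ENNReal.mul_lt_top (ENNReal.mul_lt_top ENNReal.ofReal_lt_top hCtop) hKtop.lt_top
  refine ⟨K₁, K₂, hK₁top, hK₂top, fun u hu => ?_⟩
  -- Step 0: the finite quantities `a₀ = ‖Ṡ₀ u‖_∞`, `N = sup_n 2^{(n+1)s} ‖Δ̇_{n+1} u‖_∞`
  have hfin : eLpNormDistrib ∞ (lowFreqCutoff 0 u) < ⊤ ∧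
      eLpNorm (lpBlockWeightSucc s ∞ u) ∞ Measure.count < ⊤ := ENNReal.add_lt_top.1 hu
  set N : ℝ≥0∞ := eLpNorm (lpBlockWeightSucc s ∞ u) ∞ Measure.count with hN
  have hNtop : N ≠ ⊤ := hfin.2.ne
  have hAle : ∀ n : ℕ, eLpNormDistrib ∞ (lpBlock ((n : ℤ) + 1) u) ≤
      (2 : ℝ≥0∞) ^ (-((((n : ℤ) + 1 : ℤ) : ℝ) * s)) * N := fun n => eLpNormDistrib_lpBlock_succ_le'' s ∞ u n
  have h2t : ∀ t : ℝ, (2 : ℝ≥0∞) ^ t ≠ ⊤ := fun t => by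
    rw [Ne, ENNReal.rpow_eq_top_iff]
    norm_num
  have hblk_fin : ∀ n : ℕ, eLpNormDistrib ∞ (lpBlock ((n : ℤ) + 1) u) < ⊤ := fun n =>
    (hAle n).trans_lt (ENNReal.mul_lt_top (h2t _).lt_top hNtop.lt_top)
  -- Step 1: smooth representatives of the blocks and of `Ṡ₀ u`
  choose g hgc hgb hgm hgrep using fun n : ℕ => hrep ((n : ℤ) + 1) u (hblk_fin n)
  obtain ⟨g₀, hg₀c, hg₀b, hg₀m, hg₀rep⟩ := hrep₀ u hfin.1
  set S₀ : ℝ≥0∞ := eLpNormDistrib ∞ (lowFreqCutoff 0 u) with hS₀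
  set B₀ : ℕ → ℝ := fun m => A₀ m * (C₀ * S₀).toReal with hB₀def
  have hB₀ : ∀ (m : ℕ) (x : E), ‖iteratedFDeriv ℝ m g₀ x‖ ≤ B₀ m := hg₀b
  -- Step 2: the bounds `‖Dᵐ g_n‖ ≤ v m n = A_m R 2^{(n+1)(m-s)}`, `R = (C N).toReal`
  set R : ℝ := (C * N).toReal with hR
  have hR0 : 0 ≤ R := ENNReal.toReal_nonneg
  set v : ℕ → ℕ → ℝ := fun m n => A m * R * (2 : ℝ) ^ ((((n : ℤ) + 1 : ℤ) : ℝ) * ((m : ℝ) - s)) with hv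
  have hv0 : ∀ m n, 0 ≤ v m n := fun m n => mul_nonneg (mul_nonneg (hA0 m) hR0) (Real.rpow_nonneg zero_le_two _)
  have hgv : ∀ (m n : ℕ) (x : E), ‖iteratedFDeriv ℝ m (g n) x‖ ≤ v m n := by
    intro m n x
    refine (hgb n m x).trans ?_
    have h1 : (C * eLpNormDistrib ∞ (lpBlock ((n : ℤ) + 1) u)).toReal ≤
        (2 : ℝ) ^ (-((((n : ℤ) + 1 : ℤ) : ℝ) * s)) * R := by
      calc (C * eLpNormDistrib ∞ (lpBlock ((n : ℤ) + 1) u)).toReal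
          ≤ (C * ((2 : ℝ≥0∞) ^ (-((((n : ℤ) + 1 : ℤ) : ℝ) * s)) * N)).toReal := by
            refine ENNReal.toReal_mono (ENNReal.mul_ne_top hCtop.ne (ENNReal.mul_ne_top
              (h2t _) hNtop)) ?_
            gcongr
            exact hAle n
        _ = (2 : ℝ) ^ (-((((n : ℤ) + 1 : ℤ) : ℝ) * s)) * R := by
            rw [mul_left_comm, ENNReal.toReal_mul, ← ENNReal.toReal_rpow, ENNReal.toReal_ofNat, hR]
    calc A m * (2 : ℝ) ^ ((((n : ℤ) + 1 : ℤ) : ℝ) * m) * (C * eLpNormDistrib ∞ (lpBlock ((n : ℤ) + 1) u)).toReal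
        ≤ A m * (2 : ℝ) ^ ((((n : ℤ) + 1 : ℤ) : ℝ) * m) * ((2 : ℝ) ^ (-((((n : ℤ) + 1 : ℤ) : ℝ) * s)) * R) := by
          gcongr
          exact mul_nonneg (hA0 m) (Real.rpow_nonneg zero_le_two _)
      _ = v m n := by
          simp only [hv]
          rw [show (((n : ℤ) + 1 : ℤ) : ℝ) * ((m : ℝ) - s) =
              (((n : ℤ) + 1 : ℤ) : ℝ) * m + -((((n : ℤ) + 1 : ℤ) : ℝ) * s) by ring,
            Real.rpow_add two_pos]
          ring
  -- geometric form of `v` and summability for `m ≤ k`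
  have hvgeo : ∀ m n, v m n = A m * R * (2 : ℝ) ^ ((m : ℝ) - s) * ((2 : ℝ) ^ ((m : ℝ) - s)) ^ n := by
    intro m n
    simp only [hv]
    rw [show (((n : ℤ) + 1 : ℤ) : ℝ) = ((n + 1 : ℕ) : ℝ) by push_cast; ring, two_rpow_natCast_mul, pow_succ]
    ring
  have hvsum : ∀ m : ℕ, m ≤ k → Summable (v m) := by
    intro m hm
    have hρ0 : 0 ≤ (2 : ℝ) ^ ((m : ℝ) - s) := Real.rpow_nonneg zero_le_two _
    have hρ1 : (2 : ℝ) ^ ((m : ℝ) - s) < 1 := by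
      refine Real.rpow_lt_one_of_one_lt_of_neg one_lt_two ?_
      have : (m : ℝ) ≤ k := by exact_mod_cast hm
      rw [hs]; linarith
    have h := (summable_geometric_of_lt_one hρ0 hρ1).mul_left (A m * R * (2 : ℝ) ^ ((m : ℝ) - s))
    refine h.congr fun n => ?_
    rw [hvgeo]
  -- Step 3: the series `G = ∑ g_n` is `C^k` with `Dᵐ G = ∑ Dᵐ g_n`, `m ≤ k`
  have hgck : ∀ n, ContDiff ℝ ((k : ℕ∞) : WithTop ℕ∞) (g n) := fun n =>
    (hgc n).of_le (by exact_mod_cast le_top)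
  set G : E → F := fun x => ∑' n, g n x with hGdef
  have hvsum' : ∀ m : ℕ, (m : ℕ∞) ≤ (k : ℕ∞) → Summable (v m) := fun m hm =>
    hvsum m (by exact_mod_cast hm)
  have hgv' : ∀ (m : ℕ) (n : ℕ) (x : E), (m : ℕ∞) ≤ (k : ℕ∞) → ‖iteratedFDeriv ℝ m (g n) x‖ ≤ v m n :=
    fun m n x _ => hgv m n x
  have hGc : ContDiff ℝ ((k : ℕ∞) : WithTop ℕ∞) G := contDiff_tsum hgck hvsum' hgv'
  have hGD : ∀ m : ℕ, m ≤ k → ∀ x, iteratedFDeriv ℝ m G x = ∑' n, iteratedFDeriv ℝ m (g n) x :=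
    fun m hm x => iteratedFDeriv_tsum_apply hgck hvsum' hgv' (by exact_mod_cast hm) x
  have hGDsum : ∀ m : ℕ, m ≤ k → ∀ x, Summable fun n => iteratedFDeriv ℝ m (g n) x := fun m hm x =>
    Summable.of_norm_bounded (hvsum m hm) fun n => hgv m n x
  have hGDb : ∀ m : ℕ, m ≤ k → ∀ x, ‖iteratedFDeriv ℝ m G x‖ ≤ ∑' n, v m n := by
    intro m hm x
    rw [hGD m hm x]
    have hs' : Summable fun n => ‖iteratedFDeriv ℝ m (g n) x‖ :=
      (hvsum m hm).of_nonneg_of_le (fun n => norm_nonneg _) fun n => hgv m n x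
    exact (norm_tsum_le_tsum_norm hs').trans (Summable.tsum_le_tsum (fun n => hgv m n x) hs' (hvsum m hm))
  -- Step 4: the function `f = g₀ + G`
  set f : E → F := fun x => g₀ x + G x with hf_def
  have hg₀ck : ContDiff ℝ ((k : ℕ∞) : WithTop ℕ∞) g₀ := hg₀c.of_le (by exact_mod_cast le_top)
  have hfc : ContDiff ℝ k f := by
    have : ContDiff ℝ ((k : ℕ∞) : WithTop ℕ∞) f := hg₀ck.add hGc
    exact_mod_cast this
  have hfD : ∀ m : ℕ, m ≤ k → ∀ x, iteratedFDeriv ℝ m f x = iteratedFDeriv ℝ m g₀ x + iteratedFDeriv ℝ m G x := by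
    intro m hm x
    have h1 : ContDiffAt ℝ m g₀ x := (hg₀ck.of_le (by exact_mod_cast hm)).contDiffAt
    have h2 : ContDiffAt ℝ m G x := (hGc.of_le (by exact_mod_cast hm)).contDiffAt
    exact iteratedFDeriv_add_apply h1 h2
  have hfDb : ∀ m : ℕ, m ≤ k → ∀ x, ‖iteratedFDeriv ℝ m f x‖ ≤ B₀ m + ∑' n, v m n := fun m hm x => by
    rw [hfD m hm x]
    exact (norm_add_le _ _).trans (add_le_add (hB₀ m x) (hGDb m hm x))
  -- Step 5: the Hölder estimate for `D^k f`
  -- Lipschitz bounds through `D^{k+1}`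
  have hktop : ((k : ℕ∞) : WithTop ℕ∞) < ((⊤ : ℕ∞) : WithTop ℕ∞) := by exact_mod_cast ENat.coe_lt_top k
  have hlipg₀ : ∀ x y, ‖iteratedFDeriv ℝ k g₀ x - iteratedFDeriv ℝ k g₀ y‖ ≤ B₀ (k + 1) * ‖x - y‖ := by
    intro x y
    have hd : Differentiable ℝ (iteratedFDeriv ℝ k g₀) := hg₀c.differentiable_iteratedFDeriv hktop
    refine Convex.norm_image_sub_le_of_norm_fderiv_le (s := Set.univ) (fun z _ => hd.differentiableAt)
      (fun z _ => ?_) convex_univ (Set.mem_univ y) (Set.mem_univ x)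
    rw [norm_fderiv_iteratedFDeriv]
    exact hB₀ (k + 1) z
  have hlipg : ∀ n x y, ‖iteratedFDeriv ℝ k (g n) x - iteratedFDeriv ℝ k (g n) y‖ ≤ v (k + 1) n * ‖x - y‖ := by
    intro n x y
    have hd : Differentiable ℝ (iteratedFDeriv ℝ k (g n)) := (hgc n).differentiable_iteratedFDeriv hktop
    refine Convex.norm_image_sub_le_of_norm_fderiv_le (s := Set.univ) (fun z _ => hd.differentiableAt)
      (fun z _ => ?_) convex_univ (Set.mem_univ y) (Set.mem_univ x)
    rw [norm_fderiv_iteratedFDeriv]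
    exact hgv (k + 1) n z
  -- the terms of the series: `min(2 v_k, h v_{k+1}) ≤ 2 A' R h^r m_{n+1}`
  have hterm : ∀ (n : ℕ) (x y : E), x ≠ y →
      ‖iteratedFDeriv ℝ k (g n) x - iteratedFDeriv ℝ k (g n) y‖ₑ ≤
        ENNReal.ofReal (2 * A' * R * ‖x - y‖ ^ (r : ℝ)) *
          ENNReal.ofReal (min ((2 : ℝ) ^ ((n : ℤ) + 1) * ‖x - y‖) 1 *
            ((2 : ℝ) ^ ((n : ℤ) + 1) * ‖x - y‖) ^ (-(r : ℝ))) := by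
    intro n x y hxy
    have hh : 0 < ‖x - y‖ := norm_pos_iff.2 (sub_ne_zero.2 hxy)
    set j : ℤ := (n : ℤ) + 1 with hj
    have hmin : ‖iteratedFDeriv ℝ k (g n) x - iteratedFDeriv ℝ k (g n) y‖ ≤
        min (2 * v k n) (‖x - y‖ * v (k + 1) n) := by
      refine le_min ?_ ?_
      · calc _ ≤ ‖iteratedFDeriv ℝ k (g n) x‖ + ‖iteratedFDeriv ℝ k (g n) y‖ := norm_sub_le _ _
          _ ≤ v k n + v k n := add_le_add (hgv k n x) (hgv k n y)
          _ = 2 * v k n := by ring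
      · rw [mul_comm]; exact hlipg n x y
    -- rewrite the two bounds in dyadic form
    have hvk : v k n = A k * R * (2 : ℝ) ^ (-((j : ℝ) * r)) := by
      simp only [hv, hs, hj]
      congr 1
      rw [show ((k : ℝ) - ((k : ℝ) + r)) = -(r : ℝ) by ring]
      congr 1; ring
    have hvk1 : v (k + 1) n = A (k + 1) * R * (2 : ℝ) ^ ((j : ℝ) * (1 - r)) := by
      simp only [hv, hs, hj]
      congr 1
      push_cast
      rw [show ((k : ℝ) + 1 - ((k : ℝ) + r)) = 1 - (r : ℝ) by ring]
    have hreal : min (2 * v k n) (‖x - y‖ * v (k + 1) n) ≤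
        2 * A' * R * ‖x - y‖ ^ (r : ℝ) * (min ((2 : ℝ) ^ j * ‖x - y‖) 1 * ((2 : ℝ) ^ j * ‖x - y‖) ^ (-(r : ℝ))) := by
      rw [hvk, hvk1, show 2 * (A k * R * (2 : ℝ) ^ (-((j : ℝ) * r))) = (A k * R) * (2 * (2 : ℝ) ^ (-((j : ℝ) * r))) by ring,
        show ‖x - y‖ * (A (k + 1) * R * (2 : ℝ) ^ ((j : ℝ) * (1 - r))) =
          (A (k + 1) * R) * (‖x - y‖ * (2 : ℝ) ^ ((j : ℝ) * (1 - r))) by ring]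
      refine (min_mul_le_max_mul_min (A k * R) (A (k + 1) * R) (by positivity) (by positivity)).trans ?_
      have hmax : max (A k * R) (A (k + 1) * R) = A' * R := by
        rw [hA', max_mul_of_nonneg _ _ hR0]
      rw [hmax]
      calc A' * R * min (2 * (2 : ℝ) ^ (-((j : ℝ) * r))) (‖x - y‖ * (2 : ℝ) ^ ((j : ℝ) * (1 - r)))
          ≤ A' * R * (2 * ‖x - y‖ ^ (r : ℝ) * (min ((2 : ℝ) ^ j * ‖x - y‖) 1 * ((2 : ℝ) ^ j * ‖x - y‖) ^ (-(r : ℝ)))) :=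
            mul_le_mul_of_nonneg_left (min_two_rpow_le_two_mul_rpow_mul j r hh) (mul_nonneg hA'0 hR0)
        _ = _ := by ring
    rw [← ofReal_norm, ← ENNReal.ofReal_mul (by positivity)]
    exact ENNReal.ofReal_le_ofReal (hmin.trans hreal)
  -- summing over `n`
  have hseries : ∀ x y : E, ‖iteratedFDeriv ℝ k G x - iteratedFDeriv ℝ k G y‖ₑ ≤
      ENNReal.ofReal (2 * A' * R * ‖x - y‖ ^ (r : ℝ)) * K := by
    intro x y
    rcases eq_or_ne x y with rfl | hxy
    · rw [← edist_eq_enorm_sub, edist_self]; exact zero_le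
    have hh : 0 < ‖x - y‖ := norm_pos_iff.2 (sub_ne_zero.2 hxy)
    have hsumk : Summable (v k) := hvsum k le_rfl
    have hds : Summable fun n => ‖iteratedFDeriv ℝ k (g n) x - iteratedFDeriv ℝ k (g n) y‖ :=
      (hsumk.add hsumk).of_nonneg_of_le (fun n => norm_nonneg _) fun n =>
        (norm_sub_le _ _).trans (add_le_add (hgv k n x) (hgv k n y))
    rw [hGD k le_rfl x, hGD k le_rfl y, ← Summable.tsum_sub (hGDsum k le_rfl x) (hGDsum k le_rfl y)]
    calc ‖∑' n, (iteratedFDeriv ℝ k (g n) x - iteratedFDeriv ℝ k (g n) y)‖ₑ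
        = ENNReal.ofReal ‖∑' n, (iteratedFDeriv ℝ k (g n) x - iteratedFDeriv ℝ k (g n) y)‖ := (ofReal_norm _).symm
      _ ≤ ENNReal.ofReal (∑' n, ‖iteratedFDeriv ℝ k (g n) x - iteratedFDeriv ℝ k (g n) y‖) :=
          ENNReal.ofReal_le_ofReal (norm_tsum_le_tsum_norm hds)
      _ = ∑' n, ENNReal.ofReal ‖iteratedFDeriv ℝ k (g n) x - iteratedFDeriv ℝ k (g n) y‖ :=
          ENNReal.ofReal_tsum_of_nonneg (fun n => norm_nonneg _) hds
      _ = ∑' n, ‖iteratedFDeriv ℝ k (g n) x - iteratedFDeriv ℝ k (g n) y‖ₑ := by simp_rw [ofReal_norm]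
      _ ≤ ∑' n : ℕ, ENNReal.ofReal (2 * A' * R * ‖x - y‖ ^ (r : ℝ)) *
            ENNReal.ofReal (min ((2 : ℝ) ^ ((n : ℤ) + 1) * ‖x - y‖) 1 *
              ((2 : ℝ) ^ ((n : ℤ) + 1) * ‖x - y‖) ^ (-(r : ℝ))) := ENNReal.tsum_le_tsum fun n => hterm n x y hxy
      _ = ENNReal.ofReal (2 * A' * R * ‖x - y‖ ^ (r : ℝ)) * ∑' n : ℕ,
            ENNReal.ofReal (min ((2 : ℝ) ^ ((n : ℤ) + 1) * ‖x - y‖) 1 *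
              ((2 : ℝ) ^ ((n : ℤ) + 1) * ‖x - y‖) ^ (-(r : ℝ))) := by rw [ENNReal.tsum_mul_left]
      _ ≤ ENNReal.ofReal (2 * A' * R * ‖x - y‖ ^ (r : ℝ)) * ∑' j : ℤ,
            ENNReal.ofReal (min ((2 : ℝ) ^ j * ‖x - y‖) 1 * ((2 : ℝ) ^ j * ‖x - y‖) ^ (-(r : ℝ))) := by
          gcongr
          exact ENNReal.tsum_comp_le_tsum_of_injective (f := fun n : ℕ => (n : ℤ) + 1)
            (fun a b hab => by simpa using hab)
            (fun j : ℤ => ENNReal.ofReal (min ((2 : ℝ) ^ j * ‖x - y‖) 1 * ((2 : ℝ) ^ j * ‖x - y‖) ^ (-(r : ℝ))))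
      _ ≤ ENNReal.ofReal (2 * A' * R * ‖x - y‖ ^ (r : ℝ)) * K := by
          gcongr
          exact hK ‖x - y‖ hh
  -- the `g₀` part and the total Hölder bound
  set L : ℝ≥0∞ := ENNReal.ofReal (B₀ (k + 1) + 2 * B₀ k) + ENNReal.ofReal (2 * A' * R) * K with hL
  have hLtop : L ≠ ⊤ := ENNReal.add_ne_top.2 ⟨ENNReal.ofReal_ne_top, ENNReal.mul_ne_top ENNReal.ofReal_ne_top hKtop⟩
  have hHolder : ∀ x y : E, edist (iteratedFDeriv ℝ k f x) (iteratedFDeriv ℝ k f y) ≤ L * edist x y ^ (r : ℝ) := by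
    intro x y
    have hB0 : 0 ≤ B₀ (k + 1) := (norm_nonneg _).trans (hB₀ (k + 1) x)
    have h0 := norm_sub_le_add_mul_rpow_of_lipschitz_of_bound hB0 hlipg₀ (hB₀ k) hr0.le hr1.le x y
    have h0e : ‖iteratedFDeriv ℝ k g₀ x - iteratedFDeriv ℝ k g₀ y‖ₑ ≤
        ENNReal.ofReal (B₀ (k + 1) + 2 * B₀ k) * ‖x - y‖ₑ ^ (r : ℝ) := by
      rw [← ofReal_norm, ← ofReal_norm, ENNReal.ofReal_rpow_of_nonneg (norm_nonneg _) hr0.le,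
        ← ENNReal.ofReal_mul (by linarith [(norm_nonneg _).trans (hB₀ k x)])]
      exact ENNReal.ofReal_le_ofReal h0
    have hGe : ‖iteratedFDeriv ℝ k G x - iteratedFDeriv ℝ k G y‖ₑ ≤
        ENNReal.ofReal (2 * A' * R) * K * ‖x - y‖ₑ ^ (r : ℝ) := by
      refine (hseries x y).trans (le_of_eq ?_)
      rw [ENNReal.ofReal_mul (by positivity), ← ofReal_norm, ENNReal.ofReal_rpow_of_nonneg (norm_nonneg _) hr0.le]
      ring
    rw [hfD k le_rfl x, hfD k le_rfl y]
    calc edist (iteratedFDeriv ℝ k g₀ x + iteratedFDeriv ℝ k G x) (iteratedFDeriv ℝ k g₀ y + iteratedFDeriv ℝ k G y)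
        ≤ edist (iteratedFDeriv ℝ k g₀ x) (iteratedFDeriv ℝ k g₀ y) + edist (iteratedFDeriv ℝ k G x) (iteratedFDeriv ℝ k G y) :=
          edist_add_add_le _ _ _ _
      _ = ‖iteratedFDeriv ℝ k g₀ x - iteratedFDeriv ℝ k g₀ y‖ₑ + ‖iteratedFDeriv ℝ k G x - iteratedFDeriv ℝ k G y‖ₑ := by
          rw [edist_eq_enorm_sub, edist_eq_enorm_sub]
      _ ≤ ENNReal.ofReal (B₀ (k + 1) + 2 * B₀ k) * ‖x - y‖ₑ ^ (r : ℝ) +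
          ENNReal.ofReal (2 * A' * R) * K * ‖x - y‖ₑ ^ (r : ℝ) := add_le_add h0e hGe
      _ = L * edist x y ^ (r : ℝ) := by rw [hL, edist_eq_enorm_sub]; ring
  have hHW : HolderWith L.toNNReal r (iteratedFDeriv ℝ k f) := by
    intro x y
    rw [ENNReal.coe_toNNReal hLtop]
    exact hHolder x y
  -- Step 6: `f ∈ C^{k,r}_b ∩ L^∞`
  have hfcont : Continuous f := hfc.continuous
  have hfB : ∀ x, ‖f x‖ ≤ B₀ 0 + ∑' n, v 0 n := fun x => by
    have h := hfDb 0 (Nat.zero_le k) x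
    rwa [norm_iteratedFDeriv_zero] at h
  have hfm : MemLp f ∞ (volume : Measure E) :=
    memLp_top_of_bound hfcont.aestronglyMeasurable _ (Eventually.of_forall hfB)
  have hmem : MemContDiffHolder k r f := by
    refine ⟨hfc, fun m hm => ?_, ⟨L.toNNReal, hHW⟩⟩
    exact eSupNorm_lt_top_iff.2 ⟨_, hfDb m hm⟩
  have hident : ((hfm.toLp f : Lp F ∞ (volume : Measure E)) : 𝓢'(E, F)) = u := by
    -- Step 7: `[f] = u`: the partial sums represent `Ṡ_m u → u`, and converge to `f` in `L^∞`
    have hsum0 : Summable (v 0) := hvsum 0 (Nat.zero_le k)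
    have hgbd : ∀ n x, ‖g n x‖ ≤ v 0 n := fun n x => by
      have h := hgv 0 n x
      rwa [norm_iteratedFDeriv_zero] at h
    have hgsum : ∀ x, Summable fun n => g n x := fun x => Summable.of_norm_bounded hsum0 fun n => hgbd n x
    set Fm : ℕ → E → F := fun m x => g₀ x + ∑ n ∈ Finset.range m, g n x with hFm
    have hFm_mem : ∀ m, MemLp (Fm m) ∞ (volume : Measure E) := fun m =>
      hg₀m.add (memLp_finsetSum _ (fun n _ => hgm n))
    have hFm_coe : ∀ m : ℕ, (((hFm_mem m).toLp (Fm m) : Lp F ∞ (volume : Measure E)) : 𝓢'(E, F)) =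
        lowFreqCutoff (m : ℤ) u := by
      intro m
      induction m with
      | zero =>
          have h0 : (hFm_mem 0).toLp (Fm 0) = hg₀m.toLp g₀ := by
            rw [MemLp.toLp_eq_toLp_iff]
            exact Eventually.of_forall fun x => by simp [hFm]
          rw [h0, hg₀rep, Nat.cast_zero]
      | succ m ih =>
          have h1 : (hFm_mem (m + 1)).toLp (Fm (m + 1)) = (hFm_mem m).toLp (Fm m) + (hgm m).toLp (g m) := by
            rw [← MemLp.toLp_add, MemLp.toLp_eq_toLp_iff]
            exact Eventually.of_forall fun x => by simp [hFm, Finset.sum_range_succ, add_assoc]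
          rw [h1, coe_add_toTemperedDistribution'', ih, hgrep m, lpBlock_eq_sub_holds ((m : ℤ) + 1),
            FunLike.coe_sub, Pi.sub_apply, add_sub_cancel_right, Nat.cast_succ, add_sub_cancel]
    have hlim1 : Tendsto (fun m : ℕ => (((hFm_mem m).toLp (Fm m) : Lp F ∞ (volume : Measure E)) : 𝓢'(E, F)))
        atTop (𝓝 u) := by
      simp_rw [hFm_coe]
      exact (tendsto_lowFreqCutoff_atTop_distribution u).comp tendsto_natCast_atTop_atTop
    have hdist : ∀ m, ‖(hFm_mem m).toLp (Fm m) - hfm.toLp f‖ ≤ ∑' i, v 0 (i + m) := by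
      intro m
      have hsA : Summable fun i => v 0 (i + m) := (summable_nat_add_iff (f := v 0) m).2 hsum0
      have hpt : ∀ x, ‖(Fm m - f) x‖ ≤ ∑' i, v 0 (i + m) := by
        intro x
        have hsk : Summable fun i => ‖g (i + m) x‖ :=
          hsA.of_nonneg_of_le (fun i => norm_nonneg _) fun i => hgbd (i + m) x
        have heq : (Fm m - f) x = -∑' i, g (i + m) x := by
          simp only [Pi.sub_apply, hFm, hf_def, hGdef]
          rw [← Summable.sum_add_tsum_nat_add m (hgsum x)]
          abel
        rw [heq, norm_neg]
        exact (norm_tsum_le_tsum_norm hsk).trans (Summable.tsum_le_tsum (fun i => hgbd (i + m) x) hsk hsA)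
      rw [← MemLp.toLp_sub, Lp.norm_toLp]
      refine ENNReal.toReal_le_of_le_ofReal (tsum_nonneg fun i => hv0 0 (i + m)) ?_
      rw [eLpNorm_exponent_top]
      exact eLpNormEssSup_le_of_ae_bound (Eventually.of_forall hpt)
    have htail : Tendsto (fun m : ℕ => ∑' i, v 0 (i + m)) atTop (𝓝 0) := tendsto_sum_nat_add (v 0)
    have hlim2 : Tendsto (fun m : ℕ => ((hFm_mem m).toLp (Fm m) : Lp F ∞ (volume : Measure E))) atTop
        (𝓝 (hfm.toLp f)) := by
      rw [tendsto_iff_norm_sub_tendsto_zero]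
      exact squeeze_zero (fun m => norm_nonneg _) hdist htail
    have hlim3 : Tendsto (fun m : ℕ => (((hFm_mem m).toLp (Fm m) : Lp F ∞ (volume : Measure E)) : 𝓢'(E, F)))
        atTop (𝓝 ((hfm.toLp f : Lp F ∞ (volume : Measure E)) : 𝓢'(E, F))) :=
      ((Lp.toTemperedDistributionCLM F (volume : Measure E) ∞).continuous.tendsto _).comp hlim2
    exact tendsto_nhds_unique hlim3 hlim1
  -- Step 8: the quantitative bounds
  have hSfin : C₀ * S₀ ≠ ⊤ := ENNReal.mul_ne_top hC₀top.ne hfin.1.ne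
  have hCNfin : C * N ≠ ⊤ := ENNReal.mul_ne_top hCtop.ne hNtop
  have htsum_v : ∀ m : ℕ, m ≤ k → ∑' n, v m n = A m * R * c m := by
    intro m hm
    have hgeo := tsum_geometric_of_lt_one (hρ0' m) (hρ1' m hm)
    calc ∑' n, v m n = ∑' n, (A m * R * ρ m) * ρ m ^ n := by
          refine tsum_congr fun n => ?_
          rw [hvgeo]
      _ = (A m * R * ρ m) * ∑' n, ρ m ^ n := tsum_mul_left
      _ = A m * R * c m := by rw [hgeo, hc]; ring
  have hbound1 : ∀ m : ℕ, m ≤ k → ∀ x : E, ‖iteratedFDeriv ℝ m f x‖ₑ ≤ K₁ * (S₀ + N) := by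
    intro m hm x
    have h1 : ‖iteratedFDeriv ℝ m f x‖ ≤ A₀ m * (C₀ * S₀).toReal + A m * c m * (C * N).toReal := by
      have h := hfDb m hm x
      rw [htsum_v m hm] at h
      calc ‖iteratedFDeriv ℝ m f x‖ ≤ B₀ m + A m * R * c m := h
        _ = A₀ m * (C₀ * S₀).toReal + A m * c m * (C * N).toReal := by rw [hB₀def, hR]; ring
    have h2 : ENNReal.ofReal (A₀ m * (C₀ * S₀).toReal + A m * c m * (C * N).toReal) =
        ENNReal.ofReal (A₀ m) * (C₀ * S₀) + ENNReal.ofReal (A m * c m) * (C * N) := by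
      rw [ENNReal.ofReal_add (mul_nonneg (hA₀0 m) ENNReal.toReal_nonneg)
          (mul_nonneg (mul_nonneg (hA0 m) (hc0 m hm)) ENNReal.toReal_nonneg),
        ENNReal.ofReal_mul (hA₀0 m), ENNReal.ofReal_toReal hSfin,
        ENNReal.ofReal_mul (mul_nonneg (hA0 m) (hc0 m hm)), ENNReal.ofReal_toReal hCNfin]
    have hterm_le : ENNReal.ofReal (A₀ m) * C₀ + ENNReal.ofReal (A m * c m) * C ≤ K₁ :=
      Finset.single_le_sum (f := fun m => ENNReal.ofReal (A₀ m) * C₀ + ENNReal.ofReal (A m * c m) * C)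
        (fun _ _ => bot_le) (Finset.mem_range.2 (Nat.lt_succ_of_le hm))
    calc ‖iteratedFDeriv ℝ m f x‖ₑ = ENNReal.ofReal ‖iteratedFDeriv ℝ m f x‖ := (ofReal_norm _).symm
      _ ≤ ENNReal.ofReal (A₀ m * (C₀ * S₀).toReal + A m * c m * (C * N).toReal) :=
          ENNReal.ofReal_le_ofReal h1
      _ = ENNReal.ofReal (A₀ m) * (C₀ * S₀) + ENNReal.ofReal (A m * c m) * (C * N) := h2
      _ ≤ ENNReal.ofReal (A₀ m) * (C₀ * (S₀ + N)) + ENNReal.ofReal (A m * c m) * (C * (S₀ + N)) := by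
          gcongr
          · exact le_self_add
          · exact le_add_self
      _ = (ENNReal.ofReal (A₀ m) * C₀ + ENNReal.ofReal (A m * c m) * C) * (S₀ + N) := by ring
      _ ≤ K₁ * (S₀ + N) := mul_le_mul' hterm_le le_rfl
  have hbound2 : ∀ x y : E, edist (iteratedFDeriv ℝ k f x) (iteratedFDeriv ℝ k f y) ≤
      K₂ * (S₀ + N) * edist x y ^ (r : ℝ) := by
    intro x y
    refine (hHolder x y).trans (mul_le_mul' ?_ le_rfl)
    -- `L ≤ K₂ (S₀ + N)`
    have hL1 : ENNReal.ofReal (B₀ (k + 1) + 2 * B₀ k) =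
        ENNReal.ofReal (A₀ (k + 1) + 2 * A₀ k) * (C₀ * S₀) := by
      rw [hB₀def]
      rw [show A₀ (k + 1) * (C₀ * S₀).toReal + 2 * (A₀ k * (C₀ * S₀).toReal) =
          (A₀ (k + 1) + 2 * A₀ k) * (C₀ * S₀).toReal by ring,
        ENNReal.ofReal_mul (by linarith [hA₀0 (k + 1), hA₀0 k]), ENNReal.ofReal_toReal hSfin]
    have hL2 : ENNReal.ofReal (2 * A' * R) = ENNReal.ofReal (2 * A') * (C * N) := by
      rw [ENNReal.ofReal_mul (by positivity), hR, ENNReal.ofReal_toReal hCNfin]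
    rw [hL, hL1, hL2]
    calc ENNReal.ofReal (A₀ (k + 1) + 2 * A₀ k) * (C₀ * S₀) + ENNReal.ofReal (2 * A') * (C * N) * K
        ≤ ENNReal.ofReal (A₀ (k + 1) + 2 * A₀ k) * (C₀ * (S₀ + N)) +
            ENNReal.ofReal (2 * A') * (C * (S₀ + N)) * K := by
          gcongr
          · exact le_self_add
          · exact le_add_self
      _ = K₂ * (S₀ + N) := by rw [hK₂]; ring
  exact ⟨f, hfm, hmem, hident, hbound1, hbound2⟩

end BesovToHolderQuant

end Literature.Analysis.FunctionSpaces

end
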